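import Literature.NumberTheory.Transcendental.NesterenkoEliminationPrimeForm
import Literature.NumberTheory.Transcendental.NesterenkoEliminationZeros
import Literature.NumberTheory.Transcendental.NesterenkoEliminationChowForm
import Mathlib.RingTheory.Localization.FractionRing
import Mathlib.FieldTheory.IntermediateField.Adjoin.Basic
import HarnessLib

/-!
# Towards LNM 1752 Ch. 3 Proposition 4.11, IV: the generic linear section of a projective variety (the field of the norm form)

`Literature/NumberTheory/Transcendental/NesterenkoGenericSection.lean`. Fourth step of the discharge of
the named fact `NesterenkoPhilippon2001_ch3_prop_4_11` (Nesterenko–Philippon (eds.), LNM 1752 (2001),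
Ch. 3 Prop. 4.11 = [Nes10, Prop. 1.4]). The estimates 1)–3) of that proposition are estimates of the
NORM FORM `G(u₁, …, u_s) = a^{deg Q} ∏ₖ Q(β̄⁽ᵏ⁾)` of `Q` over the `deg 𝔭` points `β̄⁽ᵏ⁾` in which the
`s = r − 1 = dim 𝔭` generic hyperplanes `L₁ = … = L_s = 0` (`Lᵢ = ∑ⱼ u_{ij} xⱼ`) cut the projective
variety `V(𝔭)`; here `𝔭 ⊂ ℚ[x₀, …, x_m]` is a homogeneous prime of rank `r = s + 1 ≥ 2` and `Q ∉ 𝔭` a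
form. This file sets up the algebra in which that norm is taken, on a chart `x_c ∉ 𝔭`
(`exists_X_notMem_of_rank`), for the objects of `NesterenkoElimination.lean` and
`NesterenkoEliminationCharts.lean` (`Aff m = ℚ[y]`, `RT s m = ℚ[y][u_{ij} : j ≠ c]`, `affIdeal`,
`sigmaU`, `wForm`):

* `SecRing s c 𝔭 = RT s m ⧸ 𝔭'_c · RT` — the coordinate ring `(ℚ[y] ⧸ 𝔭'_c)[u_{ij} : j ≠ c]` of the
  generic section, a domain (`isDomain_secRing`); the structure map
  `secMap : ℚ[U'] → SecRing` (`u_{ij} ↦ u_{ij}` for `j ≠ c`, `u_{ic} ↦ wᵢ = −∑_{j≠c} u_{ij} ȳⱼ`, i.e.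
  `Lᵢ = 0` solved on the chart) is INJECTIVE for `s < r` (`injective_secMap`: its kernel is
  `Ī(s) = 0`, `elimIdeal_eq_comap_sigmaU`, `elimIdeal_eq_bot_of_lt`), so that the fraction field
  `L = Frac(SecRing)` is an extension of `K' = ℚ(U')`;
* the chart coordinates `ȳ_l ∈ SecRing` (`ybar`) and, for the associated form `F` of `𝔭` in
  `r = s + 1` groups of variables (any `F ∈ Ī(s+1)` in fact), the specialised polynomials
  `P_l(t) = F(u₁, …, u_s; t e_c + e_l) ∈ ℚ[U'][t]` (`specLast`) with **`P_l(−ȳ_l) = 0` in `SecRing`**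
  (`eval₂_specLast_neg_ybar`): substitute `x_c ↦ 1`, `x_l ↦ ȳ_l`, `u_{ic} ↦ wᵢ` (`i ≤ s`),
  `u_{s+1} ↦ −ȳ_l e_c + e_l` in `F x_c^M ∈ (𝔭, L₁, …, L_{s+1})` — every generator dies;
* the leading coefficient of `P_l` is `a = F(u₁, …, u_s; e_c)` (`coeff_specLast_eq_aLead`,
  block-homogeneity of `F`), and **`a ≠ 0`** for `F = chowForm 𝔭 (s + 1)` (`aLead_chowForm_ne_zero`):
  `a(λ) = 0` iff the hyperplanes `λ` and `x_c = 0` have a common zero on `V(𝔭)` (zeros theorem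
  `aeval_chowForm_eq_zero_iff`), which fails for `λ` avoiding the witnesses of the finitely many
  minimal primes of `𝔭 + (x_c)` (`exists_witness_projZeros_disjoint`);
* hence `P_l ≠ 0` (`specLast_chowForm_ne_zero`): every `ȳ_l` satisfies a non-trivial polynomial
  equation of degree `≤ deg 𝔭` over `ℚ[U']`, so that (sequel) `L / K'` is a finite extension, in
  which the norm form of Prop. 4.11 will be the norm.

Definitions here are plumbing with bodies (`SecRing`, `secMap`, `ybar`, `lastVal`, `specLast`,
`aLead`, `secXVal`, `secUVal`, `secEval`, `liftUX`, `firstMono`); no named facts.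

## References

* [NesterenkoPhilippon2001] LNM 1752 (2001), Ch. 3 §4, Def. 4.3, Prop. 4.4 (p. 38), Prop. 4.11
  (pp. 40–41).
* [Nes10] Yu. V. Nesterenko, Proc. Steklov Inst. Math. 218 (1997) 294–331, Prop. 1.4.
* [HodgePedoe1994] W. V. D. Hodge, D. Pedoe, *Methods of Algebraic Geometry* II, Ch. X §§6–7
  (the generic linear section and the Cayley form).
-/

noncomputable section

open MvPolynomial
open Literature.AlgebraicGeometry.Motives

attribute [local instance] MvPolynomial.gradedAlgebra

namespace Literature.NumberTheory.Transcendental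

namespace Nesterenko

variable {m : ℕ}

/-! ### The coordinate ring of the generic section on the chart `x_c ≠ 0` -/

/-- `SecRing s c 𝔭 = ℚ[y][u_{ij} : j ≠ c] ⧸ 𝔭'_c = (ℚ[y] ⧸ 𝔭'_c)[u_{ij} : i ≤ s, j ≠ c]`: the
coordinate ring of the section of `V(𝔭)` by the `s` generic hyperplanes on the chart `x_c = 1`.
[cite: NesterenkoPhilippon2001, Ch. 3 Def. 4.3 (p. 38)] -/
abbrev SecRing (s : ℕ) (c : Fin (m + 1)) (𝔭 : Ideal (Rx m)) : Type :=
  RT s m ⧸ (affIdeal c 𝔭).map (C : Aff m →+* RT s m)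

/-- `SecRing` is a domain for a prime `𝔭` and a chart `x_c ∉ 𝔭`. [folklore] -/
theorem isDomain_secRing {𝔭 : Ideal (Rx m)} (h𝔭 : 𝔭.IsPrime)
    (hhom : 𝔭.IsHomogeneous (homogeneousSubmodule (Fin (m + 1)) ℚ)) {c : Fin (m + 1)}
    (hc : (X c : Rx m) ∉ 𝔭) (s : ℕ) : IsDomain (SecRing s c 𝔭) := by
  haveI := isPrime_map_C (σ := Fin s × Fin m) (isPrime_affIdeal h𝔭 hhom hc)
  exact Ideal.Quotient.isDomain _

/-- The structure map `ℚ[U'] → SecRing`: `u_{ij} ↦ u_{ij}` (`j ≠ c`), `u_{ic} ↦ wᵢ = −∑_{j ≠ c} u_{ij} ȳⱼ`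
(the quotient map after `sigmaU`). [cite: NesterenkoPhilippon2001, Ch. 3 Def. 4.3 (p. 38)] -/
def secMap (s : ℕ) (c : Fin (m + 1)) (𝔭 : Ideal (Rx m)) : RU s m →ₐ[ℚ] SecRing s c 𝔭 :=
  (Ideal.Quotient.mkₐ ℚ _).comp (sigmaU s m c)

/-- `secMap` unfolded. [folklore] -/
theorem secMap_apply (s : ℕ) (c : Fin (m + 1)) (𝔭 : Ideal (Rx m)) (G : RU s m) :
    secMap s c 𝔭 G = Ideal.Quotient.mk _ (sigmaU s m c G) := rfl

/-- **`secMap` is injective for `s < r = dim ℚ[x̲] ⧸ 𝔭`**: its kernel is `Ī(s) = 0`.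
[cite: NesterenkoPhilippon2001, Ch. 3 Prop. 4.4 (p. 38)] -/
theorem injective_secMap {𝔭 : Ideal (Rx m)} (h𝔭 : 𝔭.IsPrime)
    (hhom : 𝔭.IsHomogeneous (homogeneousSubmodule (Fin (m + 1)) ℚ)) {c : Fin (m + 1)}
    (hc : (X c : Rx m) ∉ 𝔭) {r s : ℕ} (hdim : ringKrullDim (Rx m ⧸ 𝔭) = r) (hs : s < r) :
    Function.Injective (secMap s c 𝔭) := by
  rw [injective_iff_map_eq_zero]
  intro G hG
  rw [secMap_apply, Ideal.Quotient.eq_zero_iff_mem, ← Ideal.mem_comap,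
    ← elimIdeal_eq_comap_sigmaU h𝔭 hhom hc s, elimIdeal_eq_bot_of_lt h𝔭 hhom hdim hs] at hG
  exact hG

/-- The chart coordinate `ȳ_l ∈ SecRing` (`y_l = x_{c.succAbove l} / x_c`). [folklore] -/
def ybar (s : ℕ) (c : Fin (m + 1)) (𝔭 : Ideal (Rx m)) (l : Fin m) : SecRing s c 𝔭 :=
  Ideal.Quotient.mk _ (C (X l))

/-! ### Specialising the last group of variables: `u_{s+1} ↦ t e_c + e_l` -/

/-- The values `t e_c + e_l` for the last group: `u_{s+1,c} ↦ t`, `u_{s+1, c.succAbove l} ↦ 1`, the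
other `u_{s+1,j} ↦ 0` (in any `ℚ`-algebra `B`, `t ∈ B`). [folklore] -/
def lastVal {B : Type*} [CommRing B] (c : Fin (m + 1)) (l : Fin m) (t : B) : Fin (m + 1) → B :=
  Fin.insertNth (α := fun _ => B) c t fun j => if j = l then 1 else 0

/-- `lastVal` at `j = c`. [folklore] -/
theorem lastVal_same {B : Type*} [CommRing B] (c : Fin (m + 1)) (l : Fin m) (t : B) :
    lastVal c l t c = t := by
  simp [lastVal]

/-- `lastVal` at `j = c.succAbove j'`. [folklore] -/
theorem lastVal_succAbove {B : Type*} [CommRing B] (c : Fin (m + 1)) (l : Fin m) (t : B) (j : Fin m) :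
    lastVal c l t (c.succAbove j) = if j = l then 1 else 0 := by
  simp [lastVal]

/-- **`P(t) = F(u₁, …, u_s; t e_c + e_l) ∈ ℚ[U'][t]`**: the specialisation of the last group of
variables of `F ∈ ℚ[u₁, …, u_{s+1}]`. [cite: NesterenkoPhilippon2001, Ch. 3 Prop. 4.11 (pp. 40–41)] -/
def specLast (s : ℕ) (c : Fin (m + 1)) (l : Fin m) : RU (s + 1) m →ₐ[ℚ] Polynomial (RU s m) :=
  aeval fun v : Fin (s + 1) × Fin (m + 1) =>
    Fin.lastCases (motive := fun _ => Polynomial (RU s m))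
      (lastVal c l (Polynomial.X : Polynomial (RU s m)) v.2)
      (fun i => Polynomial.C (X (i, v.2))) v.1

/-- **`a = F(u₁, …, u_s; e_c) ∈ ℚ[U']`**: the specialisation `u_{s+1} ↦ e_c` (the coefficient of
`u_{s+1,c}^{deg}` when `F` is homogeneous in the last group).
[cite: NesterenkoPhilippon2001, Ch. 3 Prop. 4.11 (pp. 40–41)] -/
def aLead (s : ℕ) (c : Fin (m + 1)) : RU (s + 1) m →ₐ[ℚ] RU s m :=
  aeval fun v : Fin (s + 1) × Fin (m + 1) =>
    Fin.lastCases (motive := fun _ => RU s m) (if v.2 = c then 1 else 0) (fun i => X (i, v.2)) v.1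

/-- `specLast` on a variable of the first `s` groups. [folklore] -/
theorem specLast_X_castSucc (s : ℕ) (c : Fin (m + 1)) (l : Fin m) (i : Fin s) (j : Fin (m + 1)) :
    specLast s c l (X (Fin.castSucc i, j)) = Polynomial.C (X (i, j)) := by
  simp [specLast]

/-- `specLast` on a variable of the last group. [folklore] -/
theorem specLast_X_last (s : ℕ) (c : Fin (m + 1)) (l : Fin m) (j : Fin (m + 1)) :
    specLast s c l (X (Fin.last s, j)) = lastVal c l (Polynomial.X : Polynomial (RU s m)) j := by
  simp [specLast]

/-! ### The big evaluation `ℚ[U, x̲] → SecRing` and the relation `P_l(−ȳ_l) = 0` -/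

section Relation

variable (s : ℕ) (c : Fin (m + 1)) (𝔭 : Ideal (Rx m)) (l : Fin m)

/-- The values of the `x_j` in `SecRing`: `x_c ↦ 1`, `x_{c.succAbove j} ↦ ȳⱼ`. [folklore] -/
def secXVal (j : Fin (m + 1)) : SecRing s c 𝔭 :=
  Ideal.Quotient.mk _ (C (ProjectiveSpace.dehomogenize ℚ c (X j)))

/-- The values of the `u_{ij}` in `SecRing`: `σ_c` on the first `s` groups, `−ȳ_l e_c + e_l` on the
last one. [folklore] -/
def secUVal (v : Fin (s + 1) × Fin (m + 1)) : SecRing s c 𝔭 :=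
  Fin.lastCases (motive := fun _ => SecRing s c 𝔭)
    (lastVal c l (-ybar s c 𝔭 l) v.2)
    (fun i => Ideal.Quotient.mk _ (sigmaUVal s m c (i, v.2))) v.1

/-- **`Ψ_l : ℚ[U, x̲] → SecRing`** (`r = s + 1` groups). [folklore] -/
def secEval : RUX (s + 1) m →ₐ[ℚ] SecRing s c 𝔭 :=
  aeval (Sum.elim (secUVal s c 𝔭 l) (secXVal s c 𝔭))

/-- `Ψ_l` on `ℚ[x̲]` is dehomogenisation followed by the quotient map. [folklore] -/
theorem secEval_rename_inr (P : Rx m) :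
    secEval s c 𝔭 l (rename Sum.inr P) =
      Ideal.Quotient.mk _ (C (ProjectiveSpace.dehomogenize ℚ c P)) := by
  rw [secEval, aeval_rename]
  change aeval (secXVal s c 𝔭) P = _
  have h : (aeval (secXVal s c 𝔭) : Rx m →ₐ[ℚ] SecRing s c 𝔭) =
      ((Ideal.Quotient.mkₐ ℚ _).comp ((IsScalarTower.toAlgHom ℚ (Aff m) (RT s m)).comp
        (ProjectiveSpace.dehomogenize ℚ c))) := by
    refine MvPolynomial.algHom_ext fun j => ?_
    simp [secXVal]
  rw [h]
  rfl

/-- `Ψ_l(x_c) = 1`. [folklore] -/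
theorem secEval_X_inr_self : secEval s c 𝔭 l (X (Sum.inr c)) = 1 := by
  have := secEval_rename_inr s c 𝔭 l (X c)
  rwa [rename_X, ProjectiveSpace.dehomogenize_X_self, C_1, map_one] at this

/-- The embedding of `ℚ[u₁, …, u_s, x̲]` into `ℚ[u₁, …, u_{s+1}, x̲]` (first `s` groups). [folklore] -/
def liftUX : RUX s m →ₐ[ℚ] RUX (s + 1) m :=
  rename (Sum.map (fun v : Fin s × Fin (m + 1) => (Fin.castSucc v.1, v.2)) id)

/-- `Ψ_l` restricted to the first `s` groups is `Σ_c` followed by the quotient map. [folklore] -/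
theorem secEval_comp_liftUX :
    (secEval s c 𝔭 l).comp (liftUX s) = (Ideal.Quotient.mkₐ ℚ _).comp (sigmaUX s m c) := by
  refine MvPolynomial.algHom_ext fun v => ?_
  rcases v with ⟨i, j⟩ | j
  · simp [secEval, liftUX, secUVal, sigmaUX]
  · simp only [liftUX, secEval, AlgHom.comp_apply, rename_X, Sum.map_inr, id_eq, aeval_X,
      Sum.elim_inr, secXVal, Ideal.Quotient.mkₐ_eq_mk]
    rw [← sigmaUX_rename_inr s m c (X j), rename_X]

/-- The linear forms of the first `s` groups come from `ℚ[u₁, …, u_s, x̲]`. [folklore] -/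
theorem linForm_castSucc (i : Fin s) :
    linForm (s + 1) m (Fin.castSucc i) = liftUX s (linForm s m i) := by
  simp [linForm, liftUX, map_sum]

/-- `Ψ_l` kills `L_i`, `i ≤ s` (through `Σ_c`). [folklore] -/
theorem secEval_linForm_castSucc (i : Fin s) :
    secEval s c 𝔭 l (linForm (s + 1) m (Fin.castSucc i)) = 0 := by
  rw [linForm_castSucc, ← AlgHom.comp_apply, secEval_comp_liftUX, AlgHom.comp_apply,
    sigmaUX_linForm, map_zero]

/-- `Ψ_l` kills the last linear form: `L_{s+1} ↦ (−ȳ_l) · 1 + 1 · ȳ_l = 0`. [folklore] -/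
theorem secEval_linForm_last : secEval s c 𝔭 l (linForm (s + 1) m (Fin.last s)) = 0 := by
  have hx : ∀ j, secEval s c 𝔭 l (X (Sum.inr j)) =
      Ideal.Quotient.mk _ (C (ProjectiveSpace.dehomogenize ℚ c (X j))) := fun j => by
    simpa using secEval_rename_inr s c 𝔭 l (X j)
  have hu : ∀ j, secEval s c 𝔭 l (X (Sum.inl (Fin.last s, j))) = lastVal c l (-ybar s c 𝔭 l) j :=
    fun j => by simp [secEval, secUVal]
  simp only [linForm, map_sum, map_mul, hx, hu]
  rw [Fin.sum_univ_succAbove _ c, lastVal_same, ProjectiveSpace.dehomogenize_X_self, C_1, map_one,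
    mul_one]
  simp only [lastVal_succAbove, ProjectiveSpace.dehomogenize_X_succAbove]
  rw [Finset.sum_eq_single l (fun j _ hj => by rw [if_neg hj, zero_mul])
    (fun h => absurd (Finset.mem_univ l) h), if_pos rfl, one_mul, ybar, neg_add_cancel]

/-- Hence `Ψ_l` kills `(𝔭, L₁, …, L_{s+1})`. [folklore] -/
theorem extIdeal_le_ker_secEval : extIdeal 𝔭 (s + 1) ≤ RingHom.ker (secEval s c 𝔭 l) := by
  rw [extIdeal, sup_le_iff]
  constructor
  · rw [Ideal.map_le_iff_le_comap]
    intro P hP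
    rw [Ideal.mem_comap, RingHom.mem_ker]
    change secEval s c 𝔭 l (rename Sum.inr P) = 0
    rw [secEval_rename_inr, Ideal.Quotient.eq_zero_iff_mem]
    exact Ideal.mem_map_of_mem _ (dehomogenize_mem_affIdeal c hP)
  · rw [Ideal.span_le]
    rintro _ ⟨i, rfl⟩
    rw [SetLike.mem_coe, RingHom.mem_ker]
    refine Fin.lastCases ?_ (fun i => ?_) i
    · exact secEval_linForm_last s c 𝔭 l
    · exact secEval_linForm_castSucc s c 𝔭 l i

/-- `Ψ_l` on `ℚ[U]` is `P ↦ P_l(−ȳ_l)`: `specLast` followed by evaluation at `−ȳ_l` over `secMap`.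
[folklore] -/
theorem secEval_rename_inl (G : RU (s + 1) m) :
    secEval s c 𝔭 l (rename Sum.inl G) =
      Polynomial.eval₂ (secMap s c 𝔭 : RU s m →+* SecRing s c 𝔭) (-ybar s c 𝔭 l)
        (specLast s c l G) := by
  have h : ((secEval s c 𝔭 l).comp (rename Sum.inl) : RU (s + 1) m →ₐ[ℚ] SecRing s c 𝔭).toRingHom =
      (Polynomial.eval₂RingHom (secMap s c 𝔭 : RU s m →+* SecRing s c 𝔭) (-ybar s c 𝔭 l)).comp
        (specLast s c l).toRingHom := by
    refine MvPolynomial.ringHom_ext (fun a => ?_) (fun v => ?_)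
    · simp only [AlgHom.toRingHom_eq_coe, RingHom.coe_coe, AlgHom.comp_apply, rename_C,
        RingHom.comp_apply, Polynomial.coe_eval₂RingHom]
      rw [MvPolynomial.algHom_C, MvPolynomial.algHom_C, Polynomial.algebraMap_apply,
        Polynomial.eval₂_C]
      change _ = secMap s c 𝔭 (algebraMap ℚ (RU s m) a)
      rw [AlgHom.commutes]
    · rcases v with ⟨i, j⟩
      simp only [AlgHom.toRingHom_eq_coe, RingHom.coe_coe, AlgHom.comp_apply, rename_X,
        RingHom.comp_apply, Polynomial.coe_eval₂RingHom]
      refine Fin.lastCases ?_ (fun i => ?_) i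
      · rw [specLast_X_last]
        simp only [secEval, aeval_X, Sum.elim_inl, secUVal, Fin.lastCases_last]
        refine Fin.succAboveCases c ?_ (fun j => ?_) j
        · rw [lastVal_same, lastVal_same, Polynomial.eval₂_X]
        · rw [lastVal_succAbove, lastVal_succAbove]
          split_ifs <;> simp
      · rw [specLast_X_castSucc, Polynomial.eval₂_C]
        change _ = secMap s c 𝔭 (X (i, j))
        rw [secMap_apply, sigmaU_X]
        simp [secEval, secUVal]
  exact RingHom.congr_fun h G

/-- **`P_l(−ȳ_l) = 0`**: for `F ∈ Ī(s+1)` (e.g. the associated form of `𝔭` in `s + 1` groups),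
`F(u₁, …, u_s; t e_c + e_l)` vanishes at `t = −ȳ_l` in the coordinate ring of the generic section
(`x_c ∉ 𝔭` is not needed here). [cite: NesterenkoPhilippon2001, Ch. 3 Def. 4.3, Prop. 4.11 (pp. 38–41)] -/
theorem eval₂_specLast_neg_ybar {F : RU (s + 1) m} (hF : F ∈ elimIdeal 𝔭 (s + 1)) :
    Polynomial.eval₂ (secMap s c 𝔭 : RU s m →+* SecRing s c 𝔭) (-ybar s c 𝔭 l)
      (specLast s c l F) = 0 := by
  obtain ⟨M, -, hM⟩ := hF
  have h := extIdeal_le_ker_secEval s c 𝔭 l (hM c)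
  rw [RingHom.mem_ker, map_mul, map_pow, secEval_X_inr_self, one_pow, mul_one,
    secEval_rename_inl] at h
  exact h

end Relation

/-! ### The leading coefficient of `P_l` is `a = F(u₁, …, u_s; e_c)` -/

section LeadingCoeff

variable (s : ℕ) (c : Fin (m + 1)) (l : Fin m)

/-- The part of a monomial `u^γ` in the first `s` groups, as an element of `ℚ[U']`. [folklore] -/
def firstMono (γ : Fin (s + 1) × Fin (m + 1) →₀ ℕ) : RU s m :=
  ∏ i : Fin s, ∏ j : Fin (m + 1), X (i, j) ^ γ (Fin.castSucc i, j)

/-- `specLast` on a monomial: `u^γ ↦ (first part) · [γ vanishes on the last group off `{c, l}`] · t^{γ(s+1,c)}`.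
[folklore] -/
theorem specLast_monomial (γ : Fin (s + 1) × Fin (m + 1) →₀ ℕ) (a : ℚ) :
    specLast s c l (monomial γ a) =
      Polynomial.C (C a * firstMono s γ *
        ∏ j : Fin m, (if j = l then 1 else 0 : RU s m) ^ γ (Fin.last s, c.succAbove j)) *
        Polynomial.X ^ γ (Fin.last s, c) := by
  rw [specLast, aeval_monomial, Finsupp.prod_pow, Fintype.prod_prod_type, Fin.prod_univ_castSucc]
  simp only [Fin.lastCases_castSucc, Fin.lastCases_last]
  rw [Fin.prod_univ_succAbove
    (fun j => lastVal c l (Polynomial.X : Polynomial (RU s m)) j ^ γ (Fin.last s, j)) c, lastVal_same]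
  simp only [lastVal_succAbove]
  have hC : ∀ j : Fin m, ((if j = l then 1 else 0 : Polynomial (RU s m))) =
      Polynomial.C (if j = l then 1 else 0 : RU s m) := fun j => by
    split_ifs <;> simp
  simp_rw [hC, ← Polynomial.C_pow, ← map_prod]
  rw [Polynomial.algebraMap_apply, MvPolynomial.algebraMap_eq, firstMono]
  simp only [map_mul, map_prod, map_pow]
  ring

/-- `aLead` on a monomial: `u^γ ↦ (first part) · [γ vanishes on the last group off `c`]`. [folklore] -/
theorem aLead_monomial (γ : Fin (s + 1) × Fin (m + 1) →₀ ℕ) (a : ℚ) :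
    aLead s c (monomial γ a) =
      C a * firstMono s γ * ∏ j : Fin m, (0 : RU s m) ^ γ (Fin.last s, c.succAbove j) := by
  rw [aLead, aeval_monomial, Finsupp.prod_pow, Fintype.prod_prod_type, Fin.prod_univ_castSucc]
  simp only [Fin.lastCases_castSucc, Fin.lastCases_last]
  rw [Fin.prod_univ_succAbove (fun j => (if j = c then (1 : RU s m) else 0) ^ γ (Fin.last s, j)) c,
    if_pos rfl, one_pow, one_mul, MvPolynomial.algebraMap_eq, firstMono]
  have hprod : (∏ j : Fin m, (if c.succAbove j = c then (1 : RU s m) else 0) ^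
      γ (Fin.last s, c.succAbove j)) = ∏ j : Fin m, (0 : RU s m) ^ γ (Fin.last s, c.succAbove j) :=
    Finset.prod_congr rfl fun j _ => by rw [if_neg (Fin.succAbove_ne c j)]
  rw [hprod, mul_assoc]

/-- **The leading coefficient.** If `F` is homogeneous of degree `N` in the last group of variables,
the coefficient of `t^N` in `P_l(t) = F(u₁, …, u_s; t e_c + e_l)` is `a = F(u₁, …, u_s; e_c)`.
[cite: NesterenkoPhilippon2001, Ch. 3, remark after Prop. 4.4 (p. 38)] -/
theorem coeff_specLast_eq_aLead {F : RU (s + 1) m} {N : ℕ}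
    (hF : ∀ γ ∈ F.support, ∑ j : Fin (m + 1), γ (Fin.last s, j) = N) :
    (specLast s c l F).coeff N = aLead s c F := by
  classical
  conv_lhs => rw [F.as_sum]
  conv_rhs => rw [F.as_sum]
  rw [map_sum, map_sum, Polynomial.finsetSum_coeff]
  refine Finset.sum_congr rfl fun γ hγ => ?_
  rw [specLast_monomial, aLead_monomial, Polynomial.coeff_C_mul_X_pow]
  have hsum : γ (Fin.last s, c) + ∑ j : Fin m, γ (Fin.last s, c.succAbove j) = N := by
    rw [← hF γ hγ, Fin.sum_univ_succAbove _ c]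
  by_cases hzero : ∀ j : Fin m, γ (Fin.last s, c.succAbove j) = 0
  · have hc : γ (Fin.last s, c) = N := by
      rw [← hsum, Finset.sum_eq_zero fun j _ => hzero j, add_zero]
    rw [if_pos hc.symm]
    congr 1
    refine Finset.prod_congr rfl fun j _ => ?_
    rw [hzero j, pow_zero, pow_zero]
  · push Not at hzero
    obtain ⟨j₀, hj₀⟩ := hzero
    have hprod0 : ∏ j : Fin m, (0 : RU s m) ^ γ (Fin.last s, c.succAbove j) = 0 :=
      Finset.prod_eq_zero (Finset.mem_univ j₀) (zero_pow hj₀)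
    rw [hprod0, mul_zero]
    split_ifs with hc
    · -- impossible: `γ(s+1, c) = N` forces the other exponents to vanish
      exfalso
      have hle : γ (Fin.last s, c.succAbove j₀) ≤ ∑ j : Fin m, γ (Fin.last s, c.succAbove j) :=
        Finset.single_le_sum (f := fun j => γ (Fin.last s, c.succAbove j)) (fun _ _ => Nat.zero_le _)
          (Finset.mem_univ j₀)
      omega
    · rfl

/-- The degree of `P_l` is at most the degree `N` of `F` in the last group. [folklore] -/
theorem natDegree_specLast_le {F : RU (s + 1) m} {N : ℕ}
    (hF : ∀ γ ∈ F.support, ∑ j : Fin (m + 1), γ (Fin.last s, j) = N) :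
    (specLast s c l F).natDegree ≤ N := by
  classical
  conv_lhs => rw [F.as_sum]
  rw [map_sum]
  apply Polynomial.natDegree_sum_le_of_forall_le
  intro γ hγ
  rw [specLast_monomial]
  refine (Polynomial.natDegree_C_mul_X_pow_le _ _).trans ?_
  rw [← hF γ hγ, Fin.sum_univ_succAbove _ c]
  exact Nat.le_add_right _ _

/-- Hence `P_l ≠ 0` as soon as `a ≠ 0`. [folklore] -/
theorem specLast_ne_zero {F : RU (s + 1) m} {N : ℕ}
    (hF : ∀ γ ∈ F.support, ∑ j : Fin (m + 1), γ (Fin.last s, j) = N) (ha : aLead s c F ≠ 0) :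
    specLast s c l F ≠ 0 := fun h => ha (by rw [← coeff_specLast_eq_aLead s c l hF, h, Polynomial.coeff_zero])

end LeadingCoeff

/-! ### `a ≠ 0` for the associated form of a prime -/

/-- The associated form of `𝔭` in `s + 1` groups is homogeneous of degree `deg 𝔭` in the last group.
[cite: NesterenkoPhilippon2001, Ch. 3, remark after Prop. 4.4 (p. 38)] -/
theorem sum_last_eq_ideg_of_mem_support_chowForm (𝔭 : Ideal (Rx m)) (s : ℕ)
    {γ : Fin (s + 1) × Fin (m + 1) →₀ ℕ} (hγ : γ ∈ (chowForm 𝔭 (s + 1)).support) :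
    ∑ j : Fin (m + 1), γ (Fin.last s, j) = ideg 𝔭 (s + 1) :=
  bdeg_eq_ideg_of_mem_support_chowForm 𝔭 (Nat.succ_pos s) hγ (Fin.last s)

/-- Evaluating `a = F(u₁, …, u_s; e_c)` at rational values `λ` of `u₁, …, u_s` is evaluating `F` at the
complex point `(λ, e_c)`. [folklore] -/
theorem aeval_lastCases_eq_algebraMap_eval_aLead (s : ℕ) (c : Fin (m + 1)) (F : RU (s + 1) m)
    (lam : Fin s × Fin (m + 1) → ℚ) :
    aeval (fun v : Fin (s + 1) × Fin (m + 1) =>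
      Fin.lastCases (motive := fun _ => ℂ) (if v.2 = c then 1 else 0)
        (fun i => algebraMap ℚ ℂ (lam (i, v.2))) v.1) F =
      algebraMap ℚ ℂ (eval lam (aLead s c F)) := by
  have hfun : (fun v : Fin (s + 1) × Fin (m + 1) => Fin.lastCases (motive := fun _ => ℂ)
        (if v.2 = c then 1 else 0) (fun i => algebraMap ℚ ℂ (lam (i, v.2))) v.1) =
      fun v => aeval (fun w : Fin s × Fin (m + 1) => algebraMap ℚ ℂ (lam w))
        (Fin.lastCases (motive := fun _ => RU s m) (if v.2 = c then 1 else 0)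
          (fun i => X (i, v.2)) v.1) := by
    funext v
    rcases v with ⟨i, j⟩
    refine Fin.lastCases ?_ (fun i => ?_) i
    · simp only [Fin.lastCases_last]
      split_ifs <;> simp
    · simp
  rw [hfun, ← comp_aeval, AlgHom.comp_apply, ← aeval_algebraMap_comp lam (aLead s c F)]
  rfl

/-- **`a = F(u₁, …, u_s; e_c) ≠ 0`** for the associated form `F` of a homogeneous prime `𝔭` of rank
`s + 1` and a chart `x_c ∉ 𝔭`: otherwise, by the zeros theorem, for every rational `λ` the hyperplanes
`L₁(λ), …, L_s(λ)` and `x_c = 0` would have a common zero on `V(𝔭)`, i.e. on `V(𝔭 + (x_c))`, whose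
minimal primes have rank `s` and are missed by generic `λ` (`exists_witness_projZeros_disjoint`).
[cite: NesterenkoPhilippon2001, Ch. 3 Prop. 4.4 (p. 38), Prop. 4.11 (pp. 40–41)] -/
theorem aLead_chowForm_ne_zero {𝔭 : Ideal (Rx m)} (h𝔭 : 𝔭.IsPrime)
    (hhom : 𝔭.IsHomogeneous (homogeneousSubmodule (Fin (m + 1)) ℚ)) {s : ℕ}
    (hdim : ringKrullDim (Rx m ⧸ 𝔭) = (s + 1 : ℕ)) {c : Fin (m + 1)} (hc : (X c : Rx m) ∉ 𝔭) :
    aLead s c (chowForm 𝔭 (s + 1)) ≠ 0 := by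
  classical
  intro ha0
  have hpr : (elimIdeal 𝔭 (s + 1)).IsPrincipal :=
    isPrincipal_elimIdeal_of_isPrime h𝔭 hhom (Nat.succ_pos s) hdim
  -- the bad primes: minimal primes of `𝔭 + (x_c)`, each homogeneous of rank `s`
  set J : Ideal (Rx m) := 𝔭 ⊔ Ideal.span {(X c : Rx m)} with hJ
  have hJhom : J.IsHomogeneous (homogeneousSubmodule (Fin (m + 1)) ℚ) :=
    hhom.sup (Ideal.homogeneous_span _ _ fun x hx => by
      rw [Set.mem_singleton_iff] at hx; subst hx; exact ⟨1, isHomogeneous_X ℚ c⟩)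
  have hfin := J.finite_minimalPrimes_of_isNoetherianRing
  haveI := h𝔭
  have hbad : ∀ P' ∈ J.minimalPrimes, P'.IsPrime ∧
      P'.IsHomogeneous (homogeneousSubmodule (Fin (m + 1)) ℚ) ∧ ringKrullDim (Rx m ⧸ P') = s := by
    intro P' hP'
    have hprime : P'.IsPrime := hP'.1.1
    refine ⟨hprime, Literature.RingTheory.MvPolynomial.isHomogeneous_of_mem_minimalPrimes hJhom hP', ?_⟩
    have hcut := Literature.RingTheory.MvPolynomial.ringKrullDim_quotient_add_one_of_mem_minimalPrimes_sup_span
      hc hP'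
    haveI := hprime
    haveI : Algebra.FiniteType ℚ (Rx m ⧸ P') :=
      Algebra.FiniteType.of_surjective (Ideal.Quotient.mkₐ ℚ P') (Ideal.Quotient.mkₐ_surjective ℚ P')
    obtain ⟨s', hs', -⟩ :=
      Literature.RingTheory.KrullDimension.exists_ringKrullDim_eq_and_trdeg_eq ℚ (Rx m ⧸ P')
    rw [hs', hdim] at hcut
    have : s' + 1 = s + 1 := by exact_mod_cast hcut
    rw [hs']
    congr 1
    exact_mod_cast (by omega : s' = s)
  choose g hg0 hg using fun P' (hP' : P' ∈ J.minimalPrimes) =>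
    exists_witness_projZeros_disjoint (hbad P' hP').1 (hbad P' hP').2.1 (hbad P' hP').2.2
  -- rational `λ` avoiding all the witnesses
  set Pf : RU s m := ∏ P' ∈ hfin.toFinset.attach, g P'.1 (hfin.mem_toFinset.mp P'.2) with hPf
  have hPf0 : Pf ≠ 0 := Finset.prod_ne_zero_iff.mpr fun P' _ => hg0 _ _
  obtain ⟨lam, hlam⟩ := exists_eval_ne_zero hPf0
  rw [hPf, map_prod] at hlam
  have hglam : ∀ P' (hP' : P' ∈ J.minimalPrimes), eval lam (g P' hP') ≠ 0 := fun P' hP' =>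
    (Finset.prod_ne_zero_iff.mp hlam) ⟨P', hfin.mem_toFinset.mpr hP'⟩ (Finset.mem_attach _ _)
  -- the complex point `(λ, e_c)` is a zero of `F`
  let u : Fin (s + 1) × Fin (m + 1) → ℂ := fun v =>
    Fin.lastCases (motive := fun _ => ℂ) (if v.2 = c then 1 else 0)
      (fun i => algebraMap ℚ ℂ (lam (i, v.2))) v.1
  have hu0 : aeval u (chowForm 𝔭 (s + 1)) = 0 := by
    change aeval (fun v : Fin (s + 1) × Fin (m + 1) => Fin.lastCases (motive := fun _ => ℂ)
      (if v.2 = c then 1 else 0) (fun i => algebraMap ℚ ℂ (lam (i, v.2))) v.1) (chowForm 𝔭 (s + 1)) = 0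
    rw [aeval_lastCases_eq_algebraMap_eval_aLead, ha0, map_zero, map_zero]
  obtain ⟨β, hβ, hL⟩ := (aeval_chowForm_eq_zero_iff hhom hpr u).mp hu0
  -- so `β_c = 0` and `β` is a zero of some bad prime
  have hβc : β c = 0 := by
    have h := hL (Fin.last s)
    simp only [u, Fin.lastCases_last, ite_mul, one_mul, zero_mul, Finset.sum_ite_eq',
      Finset.mem_univ, if_true] at h
    exact h
  have hβJ : J ≤ RingHom.ker (aeval β : Rx m →ₐ[ℚ] ℂ) := by
    refine sup_le (fun P hP => (RingHom.mem_ker).mpr (hβ.2 P hP)) ?_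
    rw [Ideal.span_singleton_le_iff_mem, RingHom.mem_ker, aeval_X]
    exact hβc
  haveI : (RingHom.ker (aeval β : Rx m →ₐ[ℚ] ℂ)).IsPrime := RingHom.ker_isPrime _
  obtain ⟨P', hP', hP'le⟩ := Ideal.exists_minimalPrimes_le hβJ
  have hβP' : β ∈ projZeros P' := ⟨hβ.1, fun P hP => (RingHom.mem_ker).mp (hP'le hP)⟩
  refine hg P' hP' lam (hglam P' hP') β hβP' fun i => ?_
  have h := hL (Fin.castSucc i)
  simpa [u] using h

/-- Hence `P_l ≠ 0` for the associated form of a prime: `ȳ_l` satisfies a NON-TRIVIAL polynomial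
equation of degree `≤ deg 𝔭` over `ℚ[U']`. [cite: NesterenkoPhilippon2001, Ch. 3 Prop. 4.11 (pp. 40–41)] -/
theorem specLast_chowForm_ne_zero {𝔭 : Ideal (Rx m)} (h𝔭 : 𝔭.IsPrime)
    (hhom : 𝔭.IsHomogeneous (homogeneousSubmodule (Fin (m + 1)) ℚ)) {s : ℕ}
    (hdim : ringKrullDim (Rx m ⧸ 𝔭) = (s + 1 : ℕ)) {c : Fin (m + 1)} (hc : (X c : Rx m) ∉ 𝔭)
    (l : Fin m) : specLast s c l (chowForm 𝔭 (s + 1)) ≠ 0 :=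
  specLast_ne_zero s c l (fun _ hγ => sum_last_eq_ideg_of_mem_support_chowForm 𝔭 s hγ)
    (aLead_chowForm_ne_zero h𝔭 hhom hdim hc)

end Nesterenko

end Literature.NumberTheory.Transcendental

end
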